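import Mathlib.FieldTheory.Galois.Infinite
import Mathlib.FieldTheory.Finite.Basic
import Literature.NumberTheory.GaloisRepresentations.AbsGaloisGroup
import Literature.FieldTheory.Kummer.KummerCyclicLayer
import HarnessLib

/-!
# The Kummer set-up of a cyclic layer of prime index in an absolute Galois group

Topic `NumberTheory/GaloisRepresentations`; theorems only (no definition, no named fact).  For a
field `K₀`, its absolute Galois group `Γ = Gal(\bar K₀ / K₀)` acting on `\bar K₀`, a primitive
`ℓ`-th root of unity `ζ ∈ \bar K₀` with stabiliser `Z ≤ Γ`, and subgroups `H' ≤ H ≤ Γ` with `H'`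
normal of prime index `ℓ` in `H`, this file derives the hypotheses of
`Literature/FieldTheory/Kummer/KummerCyclicLayer` for `W = H ⊓ Z`, `W' = H' ⊓ Z`
(in field terms: `k = \bar K₀^H ⊆ K' = \bar K₀^{H'}` cyclic of degree `ℓ`, `W = Gal(\bar K₀/k(ζ))`,
`W' = Gal(\bar K₀ / K'(ζ))`):

* `exists_hom_ker_eq` — the cyclotomic character `χ : Γ → (ℤ/ℓ)ˣ` with kernel `Z`
  (`IsPrimitiveRoot.autToPow`); hence `relIndex_dvd_sub_one` (`[Y : Y ∩ Z] ∣ ℓ - 1` for every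
  `Y ≤ Γ`), `commutator_mem_of_ker` (`Z ⊇ [Γ, Γ]`, so `Z` is normal).
* `commutator_mem_of_relIndex_prime` — `[H, H] ≤ H'` (a normal subgroup of prime index has
  abelian quotient).
* `relIndex_inf_eq_of_prime` — **`[W : W'] = ℓ`** and `[H' : W'] = [H : W]`, `ℓ ∤ [H : W]`
  (coprimality of `ℓ` with `[H : W] ∣ ℓ - 1`); `exists_mem_inf_not_mem` — some `s ∈ W ∖ W'`.
* `exists_fixed_pow_smul_ne` — for `H'` open and `0 < i < ℓ`, `sⁱ` moves some `W'`-fixed element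
  (Galois correspondence for the closed subgroup `W'`, Mathlib `InfiniteGalois`).
* `conj_mem_inf`, `commutator_mem_inf`, `exists_smul_eq_pow` — the normalisation and commutation
  hypotheses of the isotypy lemma for every `σ ∈ H`.

## References

* S. Lang, *Algebra*, GTM 211, Ch. VI §6, §8 (cyclic and Kummer extensions). [folklore]
* J. Neukirch, *Algebraic Number Theory*, Ch. IV §1 (infinite Galois theory). [folklore]
-/

noncomputable section

open Field
open scoped IntermediateField

namespace Literature.NumberTheory.GaloisRepresentations

section Cyclotomic

variable (K₀ : Type*) [Field K₀] {ℓ : ℕ} {ζ : AlgebraicClosure K₀}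

/-- **The cyclotomic character mod `ℓ`.**  For a primitive `ℓ`-th root of unity `ζ ∈ \bar K₀`
there is a homomorphism `χ : Γ → (ℤ/ℓ)ˣ` whose kernel is the stabiliser of `ζ`
(Mathlib `IsPrimitiveRoot.autToPow`, `σ ζ = ζ ^ χ(σ)`). [folklore] -/
theorem exists_hom_ker_eq (hℓ : ℓ.Prime) (hζ : IsPrimitiveRoot ζ ℓ)
    (Z : Subgroup (absoluteGaloisGroup K₀)) (hZ : ∀ σ, σ ∈ Z ↔ σ • ζ = ζ) :
    ∃ χ : absoluteGaloisGroup K₀ →* (ZMod ℓ)ˣ, χ.ker = Z := by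
  haveI : NeZero ℓ := ⟨hℓ.ne_zero⟩
  haveI : Fact (1 < ℓ) := ⟨hℓ.one_lt⟩
  refine ⟨(hζ.autToPow K₀).comp (absoluteGaloisGroup.toAlgEquiv K₀).toMonoidHom, ?_⟩
  ext σ
  rw [MonoidHom.mem_ker, hZ, MonoidHom.comp_apply, MulEquiv.coe_toMonoidHom]
  have hspec := hζ.autToPow_spec K₀ (absoluteGaloisGroup.toAlgEquiv K₀ σ)
  change _ ↔ (absoluteGaloisGroup.toAlgEquiv K₀ σ) ζ = ζ
  constructor
  · intro h
    rw [← hspec, h, Units.val_one, ZMod.val_one, pow_one]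
  · intro h
    rw [h] at hspec
    have hval : ((hζ.autToPow K₀ (absoluteGaloisGroup.toAlgEquiv K₀ σ) : ZMod ℓ)).val = 1 := by
      apply hζ.pow_inj (ZMod.val_lt _) hℓ.one_lt
      rw [pow_one]; exact hspec
    ext
    rw [Units.val_one]
    apply ZMod.val_injective
    rw [hval, ZMod.val_one]

/-- `[Y : Y ∩ Z] ∣ ℓ - 1` for every subgroup `Y ≤ Γ`: `Y/(Y ∩ Z)` embeds in `(ℤ/ℓ)ˣ` through the
cyclotomic character. [folklore] -/
theorem relIndex_dvd_sub_one (hℓ : ℓ.Prime) (hζ : IsPrimitiveRoot ζ ℓ)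
    (Z : Subgroup (absoluteGaloisGroup K₀)) (hZ : ∀ σ, σ ∈ Z ↔ σ • ζ = ζ)
    (Y : Subgroup (absoluteGaloisGroup K₀)) : Z.relIndex Y ∣ ℓ - 1 := by
  classical
  haveI : Fact ℓ.Prime := ⟨hℓ⟩
  obtain ⟨χ, hχ⟩ := exists_hom_ker_eq K₀ hℓ hζ Z hZ
  have hker : (χ.comp Y.subtype).ker = Z.subgroupOf Y := by
    ext y
    rw [MonoidHom.mem_ker, MonoidHom.comp_apply, Subgroup.mem_subgroupOf, ← hχ, MonoidHom.mem_ker]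
    rfl
  rw [Subgroup.relIndex, ← hker, Subgroup.index_ker, ← ZMod.card_units ℓ, ← Nat.card_eq_fintype_card]
  exact Subgroup.card_subgroup_dvd_card _

/-- Commutators act trivially on `ζ` (the cyclotomic character has abelian target); in particular
the stabiliser `Z` of `ζ` is normal in `Γ`. [folklore] -/
theorem commutator_smul_eq (hℓ : ℓ.Prime) (hζ : IsPrimitiveRoot ζ ℓ)
    (a b : absoluteGaloisGroup K₀) : (a * b * a⁻¹ * b⁻¹) • ζ = ζ := by
  obtain ⟨χ, hχ⟩ := exists_hom_ker_eq K₀ hℓ hζ (MulAction.stabilizer (absoluteGaloisGroup K₀) ζ)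
    fun σ => MulAction.mem_stabilizer_iff
  have : a * b * a⁻¹ * b⁻¹ ∈ χ.ker := by
    rw [MonoidHom.mem_ker, map_mul, map_mul, map_mul, map_inv, map_inv, mul_right_comm (χ a),
      mul_inv_cancel, one_mul, mul_inv_cancel]
  rw [hχ] at this
  exact this

/-- The stabiliser `Z` of `ζ` is normal: `g z g⁻¹ ∈ Z` for `z ∈ Z`. [folklore] -/
theorem conj_mem_of_smul_eq (hℓ : ℓ.Prime) (hζ : IsPrimitiveRoot ζ ℓ)
    (Z : Subgroup (absoluteGaloisGroup K₀)) (hZ : ∀ σ, σ ∈ Z ↔ σ • ζ = ζ)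
    (g : absoluteGaloisGroup K₀) {z : absoluteGaloisGroup K₀} (hz : z ∈ Z) : g * z * g⁻¹ ∈ Z := by
  rw [hZ] at hz ⊢
  have h := commutator_smul_eq K₀ hℓ hζ g z
  rw [show g * z * g⁻¹ = (g * z * g⁻¹ * z⁻¹) * z by group, mul_smul, hz, h]

/-- Every `σ ∈ Γ` maps `ζ` to a power of `ζ`. [folklore] -/
theorem exists_smul_eq_pow (hℓ : ℓ.Prime) (hζ : IsPrimitiveRoot ζ ℓ) (σ : absoluteGaloisGroup K₀) :
    ∃ n : ℕ, σ • ζ = ζ ^ n := by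
  haveI : NeZero ℓ := ⟨hℓ.ne_zero⟩
  have h : (σ • ζ) ^ ℓ = 1 := by rw [← smul_pow', hζ.pow_eq_one, smul_one]
  obtain ⟨i, -, hi⟩ := hζ.eq_pow_of_pow_eq_one h
  exact ⟨i, hi.symm⟩

end Cyclotomic

/-! ### A normal subgroup of prime index has abelian quotient -/

section PrimeIndex

variable {G : Type*} [Group G]

/-- If `H' ≤ H` is normal of prime index, all commutators of `H` lie in `H'` (`H/H'` is cyclic).
[folklore] -/
theorem commutator_mem_of_relIndex_prime {H H' : Subgroup G} (hle : H' ≤ H)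
    (hnorm : ∀ h ∈ H, ∀ h' ∈ H', h * h' * h⁻¹ ∈ H') {p : ℕ} (hp : p.Prime)
    (hidx : H'.relIndex H = p) {a b : G} (ha : a ∈ H) (hb : b ∈ H) :
    a * b * a⁻¹ * b⁻¹ ∈ H' := by
  haveI : Fact p.Prime := ⟨hp⟩
  haveI hN : (H'.subgroupOf H).Normal :=
    (Subgroup.normal_subgroupOf_iff hle).2 fun h k hh hk => hnorm k hk h hh
  have hcard : Nat.card (H ⧸ H'.subgroupOf H) = p := by
    rw [← Subgroup.index_eq_card]; exact hidx
  haveI := isCyclic_of_prime_card hcard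
  letI : CommGroup (H ⧸ H'.subgroupOf H) := IsCyclic.commGroup
  have h1 : (QuotientGroup.mk (s := H'.subgroupOf H) (⟨a, ha⟩ * ⟨b, hb⟩ * ⟨a, ha⟩⁻¹ * ⟨b, hb⟩⁻¹) :
      H ⧸ H'.subgroupOf H) = 1 := by
    simp only [QuotientGroup.mk_mul, QuotientGroup.mk_inv]
    rw [mul_right_comm (QuotientGroup.mk (s := H'.subgroupOf H) ⟨a, ha⟩), mul_inv_cancel, one_mul,
      mul_inv_cancel]
  rw [QuotientGroup.eq_one_iff, Subgroup.mem_subgroupOf] at h1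
  simpa using h1

end PrimeIndex

/-! ### The subgroups `W = H ⊓ Z ⊇ W' = H' ⊓ Z` -/

section Setup

variable (K₀ : Type*) [Field K₀] {ℓ : ℕ} {ζ : AlgebraicClosure K₀}
variable {Z H H' : Subgroup (absoluteGaloisGroup K₀)}

/-- `W'` is normal in `W`. [folklore] -/
theorem conj_mem_inf_of_mem_inf (hℓ : ℓ.Prime) (hζ : IsPrimitiveRoot ζ ℓ)
    (hZ : ∀ σ, σ ∈ Z ↔ σ • ζ = ζ)
    (hnorm : ∀ h ∈ H, ∀ h' ∈ H', h * h' * h⁻¹ ∈ H')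
    {w : absoluteGaloisGroup K₀} (hw : w ∈ H ⊓ Z) {w' : absoluteGaloisGroup K₀} (hw' : w' ∈ H' ⊓ Z) :
    w * w' * w⁻¹ ∈ H' ⊓ Z :=
  ⟨hnorm w hw.1 w' hw'.1, conj_mem_of_smul_eq K₀ hℓ hζ Z hZ w hw'.2⟩

/-- For `σ ∈ H`: `σ⁻¹ W σ ⊆ W`. [folklore] -/
theorem inv_mul_mul_mem_inf (hℓ : ℓ.Prime) (hζ : IsPrimitiveRoot ζ ℓ)
    (hZ : ∀ σ, σ ∈ Z ↔ σ • ζ = ζ) {σ : absoluteGaloisGroup K₀} (hσ : σ ∈ H)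
    {w : absoluteGaloisGroup K₀} (hw : w ∈ H ⊓ Z) : σ⁻¹ * w * σ ∈ H ⊓ Z := by
  refine ⟨H.mul_mem (H.mul_mem (H.inv_mem hσ) hw.1) hσ, ?_⟩
  have := conj_mem_of_smul_eq K₀ hℓ hζ Z hZ σ⁻¹ hw.2
  rwa [inv_inv] at this

/-- For `σ ∈ H`: `σ⁻¹ W' σ ⊆ W'` (`H'` is normal in `H`). [folklore] -/
theorem inv_mul_mul_mem_inf' (hℓ : ℓ.Prime) (hζ : IsPrimitiveRoot ζ ℓ)
    (hZ : ∀ σ, σ ∈ Z ↔ σ • ζ = ζ)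
    (hnorm : ∀ h ∈ H, ∀ h' ∈ H', h * h' * h⁻¹ ∈ H') {σ : absoluteGaloisGroup K₀} (hσ : σ ∈ H)
    {w : absoluteGaloisGroup K₀} (hw : w ∈ H' ⊓ Z) : σ⁻¹ * w * σ ∈ H' ⊓ Z := by
  refine ⟨?_, ?_⟩
  · have := hnorm σ⁻¹ (H.inv_mem hσ) w hw.1
    rwa [inv_inv] at this
  · have := conj_mem_of_smul_eq K₀ hℓ hζ Z hZ σ⁻¹ hw.2
    rwa [inv_inv] at this

/-- For `s, σ ∈ H`: the commutator `s⁻¹ σ⁻¹ s σ` lies in `W' = H' ⊓ Z`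
(`[H, H] ≤ H'` by `commutator_mem_of_relIndex_prime`, `[Γ, Γ] ≤ Z`). [folklore] -/
theorem commutator_mem_inf (hℓ : ℓ.Prime) (hζ : IsPrimitiveRoot ζ ℓ)
    (hZ : ∀ σ, σ ∈ Z ↔ σ • ζ = ζ) (hle : H' ≤ H)
    (hnorm : ∀ h ∈ H, ∀ h' ∈ H', h * h' * h⁻¹ ∈ H') (hidx : H'.relIndex H = ℓ)
    {a b : absoluteGaloisGroup K₀} (ha : a ∈ H) (hb : b ∈ H) :
    a * b * a⁻¹ * b⁻¹ ∈ H' ⊓ Z := by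
  exact ⟨commutator_mem_of_relIndex_prime hle hnorm hℓ hidx ha hb,
    (hZ _).2 (commutator_smul_eq K₀ hℓ hζ a b)⟩

/-- `ℓ ∤ [H : W] = [H : H ∩ Z]` (it divides `ℓ - 1`). [folklore] -/
theorem not_dvd_relIndex (hℓ : ℓ.Prime) (hζ : IsPrimitiveRoot ζ ℓ)
    (hZ : ∀ σ, σ ∈ Z ↔ σ • ζ = ζ) (Y : Subgroup (absoluteGaloisGroup K₀)) :
    ¬ ℓ ∣ Z.relIndex Y := by
  intro h
  have h1 := relIndex_dvd_sub_one K₀ hℓ hζ Z hZ Y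
  have hpos : 0 < ℓ - 1 := Nat.sub_pos_of_lt hℓ.one_lt
  have h2 : ℓ ≤ ℓ - 1 := Nat.le_of_dvd hpos (h.trans h1)
  omega

/-- **`[W : W'] = ℓ` and `[H' : W'] = [H : W]`** for `W = H ⊓ Z`, `W' = H' ⊓ Z`, when `H'` is normal
of prime index `ℓ` in `H`: `[W : W']` divides `[H : H'] = ℓ`, and `ℓ` divides `[W : W'] · [H : W]`
with `ℓ ∤ [H : W]`. [folklore] -/
theorem relIndex_inf_eq_of_prime (hℓ : ℓ.Prime) (hζ : IsPrimitiveRoot ζ ℓ)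
    (hZ : ∀ σ, σ ∈ Z ↔ σ • ζ = ζ) (hle : H' ≤ H)
    (hnorm : ∀ h ∈ H, ∀ h' ∈ H', h * h' * h⁻¹ ∈ H') (hidx : H'.relIndex H = ℓ) :
    (H' ⊓ Z).relIndex (H ⊓ Z) = ℓ ∧ (H' ⊓ Z).relIndex H' = Z.relIndex H := by
  have hW'W : H' ⊓ Z ≤ H ⊓ Z := inf_le_inf_right Z hle
  have hWH : H ⊓ Z ≤ H := inf_le_left
  have hW'H' : H' ⊓ Z ≤ H' := inf_le_left
  -- (i) `[W : W'] ∣ ℓ`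
  have hdvd1 : (H' ⊓ Z).relIndex (H ⊓ Z) ∣ ℓ := by
    have h1 := Literature.FieldTheory.Kummer.relIndex_comap_dvd (H ⊓ Z).subtype hle hnorm
    rw [hidx] at h1
    have h2 : (H.comap (H ⊓ Z).subtype) = ⊤ := by
      rw [eq_top_iff]
      rintro ⟨x, hx⟩ -
      exact hx.1
    rw [h2, Subgroup.relIndex_top_right] at h1
    have h3 : (H'.comap (H ⊓ Z).subtype).index = H'.relIndex (H ⊓ Z) := rfl
    rw [h3, ← Subgroup.inf_relIndex_right] at h1
    -- `H' ⊓ (H ⊓ Z) = H' ⊓ Z`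
    have h4 : H' ⊓ (H ⊓ Z) = H' ⊓ Z := by
      rw [← inf_assoc, inf_eq_left.2 hle]
    rwa [h4] at h1
  -- (ii) the two index computations of `[H : W']`
  have hd : (H ⊓ Z).relIndex H = Z.relIndex H := Subgroup.inf_relIndex_left H Z
  have heq : (H' ⊓ Z).relIndex (H ⊓ Z) * Z.relIndex H = (H' ⊓ Z).relIndex H' * ℓ := by
    rw [← hd, Subgroup.relIndex_mul_relIndex (H' ⊓ Z) (H ⊓ Z) H hW'W hWH, ← hidx,
      Subgroup.relIndex_mul_relIndex (H' ⊓ Z) H' H hW'H' hle]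
  have hcop : Nat.Coprime ℓ (Z.relIndex H) :=
    (Nat.Prime.coprime_iff_not_dvd hℓ).2 (not_dvd_relIndex K₀ hℓ hζ hZ H)
  have hdvd2 : ℓ ∣ (H' ⊓ Z).relIndex (H ⊓ Z) := by
    have : ℓ ∣ (H' ⊓ Z).relIndex (H ⊓ Z) * Z.relIndex H := by
      rw [heq]; exact dvd_mul_left ℓ _
    exact hcop.dvd_of_dvd_mul_right this
  have hℓeq : (H' ⊓ Z).relIndex (H ⊓ Z) = ℓ := Nat.dvd_antisymm hdvd1 hdvd2
  refine ⟨hℓeq, ?_⟩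
  rw [hℓeq, mul_comm] at heq
  exact (Nat.eq_of_mul_eq_mul_right hℓ.pos heq).symm

/-- Some `s ∈ W = H ⊓ Z` is not in `W' = H' ⊓ Z` (as `[W : W'] = ℓ > 1`). [folklore] -/
theorem exists_mem_inf_not_mem (hℓ : ℓ.Prime) (hζ : IsPrimitiveRoot ζ ℓ)
    (hZ : ∀ σ, σ ∈ Z ↔ σ • ζ = ζ) (hle : H' ≤ H)
    (hnorm : ∀ h ∈ H, ∀ h' ∈ H', h * h' * h⁻¹ ∈ H') (hidx : H'.relIndex H = ℓ) :
    ∃ s ∈ H ⊓ Z, s ∉ H' ⊓ Z := by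
  by_contra h
  simp only [not_exists, not_and, not_not] at h
  have h1 : (H' ⊓ Z).relIndex (H ⊓ Z) = 1 := Subgroup.relIndex_eq_one.2 h
  rw [(relIndex_inf_eq_of_prime K₀ hℓ hζ hZ hle hnorm hidx).1] at h1
  exact hℓ.one_lt.ne' h1

/-- A power `sⁱ`, `0 < i < ℓ`, of `s ∈ W ∖ W'` is not in `W'` (the class of `s` has order `ℓ`).
[folklore] -/
theorem pow_not_mem_inf (hℓ : ℓ.Prime) (hζ : IsPrimitiveRoot ζ ℓ)
    (hZ : ∀ σ, σ ∈ Z ↔ σ • ζ = ζ) (hle : H' ≤ H)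
    (hnorm : ∀ h ∈ H, ∀ h' ∈ H', h * h' * h⁻¹ ∈ H') (hidx : H'.relIndex H = ℓ)
    {s : absoluteGaloisGroup K₀} (hs : s ∈ H ⊓ Z) (hs' : s ∉ H' ⊓ Z)
    {i : ℕ} (hi0 : 0 < i) (hi : i < ℓ) : s ^ i ∉ H' ⊓ Z := by
  intro hsi
  have hW'W : H' ⊓ Z ≤ H ⊓ Z := inf_le_inf_right Z hle
  have hnormW : ∀ w ∈ H ⊓ Z, ∀ w' ∈ H' ⊓ Z, w * w' * w⁻¹ ∈ H' ⊓ Z := fun w hw w' hw' =>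
    conj_mem_inf_of_mem_inf K₀ hℓ hζ hZ hnorm hw hw'
  have hidxW := (relIndex_inf_eq_of_prime K₀ hℓ hζ hZ hle hnorm hidx).1
  have hsℓ : s ^ ℓ ∈ H' ⊓ Z :=
    Literature.FieldTheory.Kummer.pow_mem_of_relIndex_prime hW'W hnormW hℓ hidxW hs
  obtain ⟨m, -, hm⟩ := Nat.exists_mul_mod_eq_one_of_coprime
    (Nat.coprime_of_lt_prime hi0.ne' hi hℓ).symm hℓ.one_lt
  have hdecomp : i * m = ℓ * (i * m / ℓ) + 1 := by
    have := Nat.div_add_mod (i * m) ℓ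
    rw [hm] at this
    exact this.symm
  apply hs'
  have h1 : s ^ (i * m) ∈ H' ⊓ Z := by rw [pow_mul]; exact Subgroup.pow_mem _ hsi m
  have h2 : s ^ (ℓ * (i * m / ℓ)) ∈ H' ⊓ Z := by rw [pow_mul]; exact Subgroup.pow_mem _ hsℓ _
  rw [hdecomp, pow_succ] at h1
  have := Subgroup.mul_mem _ (Subgroup.inv_mem _ h2) h1
  rwa [inv_mul_cancel_left] at this

/-- **`sⁱ` moves a `W'`-fixed element** (`0 < i < ℓ`, `H'` open): `W' = H' ⊓ Z` is open, hence
closed, so it is the fixing subgroup of its fixed field (infinite Galois correspondence, Mathlib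
`InfiniteGalois.fixingSubgroup_fixedField`), and `sⁱ ∉ W'`. [folklore] -/
theorem exists_fixed_pow_smul_ne [CharZero K₀] (hℓ : ℓ.Prime) (hζ : IsPrimitiveRoot ζ ℓ)
    (hZ : ∀ σ, σ ∈ Z ↔ σ • ζ = ζ) (hle : H' ≤ H)
    (hnorm : ∀ h ∈ H, ∀ h' ∈ H', h * h' * h⁻¹ ∈ H') (hidx : H'.relIndex H = ℓ)
    (hH'open : IsOpen (H' : Set (absoluteGaloisGroup K₀)))
    {s : absoluteGaloisGroup K₀} (hs : s ∈ H ⊓ Z) (hs' : s ∉ H' ⊓ Z)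
    {i : ℕ} (hi0 : 0 < i) (hi : i < ℓ) :
    ∃ θ : AlgebraicClosure K₀, (∀ w ∈ H' ⊓ Z, w • θ = θ) ∧ (s ^ i) • θ ≠ θ := by
  haveI : NeZero ℓ := ⟨hℓ.ne_zero⟩
  -- `Z` is open: it contains the fixing subgroup of `K₀(ζ)`
  have hZopen : IsOpen (Z : Set (absoluteGaloisGroup K₀)) := by
    haveI : FiniteDimensional K₀ K₀⟮ζ⟯ :=
      IntermediateField.adjoin.finiteDimensional (Algebra.IsIntegral.isIntegral ζ)
    have h1 : IsOpen ((K₀⟮ζ⟯.fixingSubgroup.comap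
        (absoluteGaloisGroup.toAlgEquiv K₀).toMonoidHom : Subgroup (absoluteGaloisGroup K₀)) :
          Set (absoluteGaloisGroup K₀)) :=
      IntermediateField.fixingSubgroup_isOpen K₀⟮ζ⟯
    refine Subgroup.isOpen_mono ?_ h1
    intro σ hσ
    rw [Subgroup.mem_comap, MulEquiv.coe_toMonoidHom, IntermediateField.mem_fixingSubgroup_iff] at hσ
    rw [hZ]
    exact hσ ζ (IntermediateField.mem_adjoin_simple_self K₀ ζ)
  have hW'closed : IsClosed (((H' ⊓ Z : Subgroup (absoluteGaloisGroup K₀)) :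
      Set (absoluteGaloisGroup K₀))) :=
    Subgroup.isClosed_of_isOpen _ (hH'open.inter hZopen)
  -- Galois correspondence for the closed subgroup `W'`
  have hGC := InfiniteGalois.fixingSubgroup_fixedField
    (K := AlgebraicClosure K₀) (k := K₀) ⟨H' ⊓ Z, hW'closed⟩
  have hGC' : (IntermediateField.fixedField
      ((H' ⊓ Z : Subgroup (absoluteGaloisGroup K₀)) :
        Subgroup (AlgebraicClosure K₀ ≃ₐ[K₀] AlgebraicClosure K₀))).fixingSubgroup =
      ((H' ⊓ Z : Subgroup (absoluteGaloisGroup K₀)) :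
        Subgroup (AlgebraicClosure K₀ ≃ₐ[K₀] AlgebraicClosure K₀)) := hGC
  have hnot : s ^ i ∉ H' ⊓ Z := pow_not_mem_inf K₀ hℓ hζ hZ hle hnorm hidx hs hs' hi0 hi
  have hnot' : absoluteGaloisGroup.toAlgEquiv K₀ (s ^ i) ∉
      (IntermediateField.fixedField
        ((H' ⊓ Z : Subgroup (absoluteGaloisGroup K₀)) :
          Subgroup (AlgebraicClosure K₀ ≃ₐ[K₀] AlgebraicClosure K₀))).fixingSubgroup := fun h =>
    hnot ((Subgroup.ext_iff.mp hGC' (absoluteGaloisGroup.toAlgEquiv K₀ (s ^ i))).mp h)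
  rw [IntermediateField.mem_fixingSubgroup_iff] at hnot'
  simp only [not_forall] at hnot'
  obtain ⟨θ, hθ, hne⟩ := hnot'
  refine ⟨θ, fun w hw => ?_, hne⟩
  rw [IntermediateField.mem_fixedField_iff] at hθ
  exact hθ (absoluteGaloisGroup.toAlgEquiv K₀ w) hw

end Setup

end Literature.NumberTheory.GaloisRepresentations
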